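import Literature.MathematicalPhysics.KineticTheory.LangevinChainNESS
import Literature.MathematicalPhysics.KineticTheory.LangevinSemigroup
import Mathlib.Analysis.Calculus.LineDeriv.IntegrationByParts
import Mathlib.Analysis.Normed.Group.Bounded
import Mathlib.MeasureTheory.Integral.Prod
import Mathlib.Probability.Kernel.Composition.IntegralCompProd
import Mathlib.Probability.Kernel.Composition.MeasureComp
import HarnessLib

/-!
# Invariant measures of the Langevin chain are weak steady states; the named fact from Thm 2.13

Trunk T-KINETIC (Literature/MathematicalPhysics/KineticTheory). Proof layer for the named fact
`CuneoEckmannHairerReyBellet2018_pinnedChain` of `LangevinChainNESS.lean` (the weak-stationarity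
corollary of Cuneo–Eckmann–Hairer–Rey-Bellet 2018, Thm 2.13, for the pinned anharmonic chain
`Literature.HeatConduction.pinnedChain ω₂ lam β γ` of `FouriersLaw.lean`).

## Main result

* `CuneoEckmannHairerReyBellet2018_pinnedChain_of_thm213`: the named fact
  `CuneoEckmannHairerReyBellet2018_pinnedChain` FOLLOWS from the named fact
  `CuneoEckmannHairerReyBellet2018_thm213` of `LangevinSemigroup.lean`, which is Theorem 2.13 of
  the source stated verbatim (existentially over the Markov-semigroup interface
  `LangevinChainSemigroup`). This proves the claim made in the docstring of the fact ("the
  WEAK-STATIONARITY COROLLARY of parts 2–3 … with part 1 it is absolutely continuous") and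
  reduces its eventual discharge to that of Theorem 2.13 itself (Hörmander bracket condition,
  Lyapunov function, Harris theorem — not in the tree).

## The argument (Cuneo–Eckmann–Hairer–Rey-Bellet 2018, §3, p. 7: "The solutions to (3.1) form
a Markov process whose generator `L` is given by (3.2)"; Thm 2.13)

Let `S` be a `LangevinChainSemigroup P N T_L T_R` (Markov kernels `P_t` with the Dynkin identity
`P_t f - f = ∫₀ᵗ P_s (L f) ds` on `C_c^∞`, `L = OscillatorChain.generator P N T_L T_R`) and `μ`
a finite invariant measure (`μ P_t = μ`).

* `LangevinChainSemigroup.IsInvariant.integral_act`: `∫ P_t g dμ = ∫ g dμ` for `g ∈ L¹(μ)`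
  (Mathlib's `Kernel.integral_comp` for `P_t ∘ₖ const`, and `μ.bind P_t = μ`).
* `LangevinChainSemigroup.IsInvariant.integral_generator_eq_zero`: if `L f` is bounded and
  measurable then `∫ L f dμ = 0`. Proof: integrate Dynkin's identity at `t = 1` against `μ`;
  the left side vanishes by invariance; on the right, Fubini (the integrand
  `(z, s) ↦ P_s(Lf)(z)` is jointly measurable by the measurability field of the interface and
  bounded by `‖Lf‖_∞`) and invariance give `∫₀¹ ∫ P_s(Lf) dμ ds = ∫ L f dμ`.
* For `C¹` potentials `U, V` and `f ∈ C_c^∞`, `L f` is continuous with compact support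
  (`OscillatorChain.continuous_generator`, `OscillatorChain.hasCompactSupport_generator`), so
  `LangevinChainSemigroup.IsInvariant.isSteadyState`: an invariant probability measure under
  which the bond currents are integrable is an `OscillatorChain.IsSteadyState`.
* For the pinned chain (`ω₂, lam, β ≥ 0`) the currents are polynomially bounded,
  `|j_i| ≤ N(3+β)/2 · (1+H)²` (`pinnedChain_abs_bondCurrent_le`), hence `μ`-integrable as soon
  as `e^{ϑH} ∈ L¹(μ)` for some `ϑ > 0` (`pinnedChain_integrable_bondCurrent_of_integrable_exp`);
  Theorem 2.13 (2) gives this for `0 < ϑ < 1/max(T_L,T_R)`, and (1) gives the smooth density,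
  whence `μ ≪ Lebesgue` (`HasSmoothDensity.absolutelyContinuous`).

## Infrastructure (theorems only; used again by `LangevinChainGibbs.lean`)

* `partialQ_eq_lineDeriv`, `partialP_eq_lineDeriv`: the coordinate derivatives of
  `FouriersLaw.lean` ARE Mathlib line derivatives along the coordinate vectors `(e_i, 0)`,
  `(0, e_i)` of phase space (for every `f`, same junk value), so `fderiv`/`ContDiff` calculus
  applies (`continuous_partialQ/P`, `contDiff_partialP`, `hasCompactSupport_partialQ/P`).
* Regularity of the Hamiltonian (`contDiff_hamiltonian`, `continuous_partialQ_hamiltonian`).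
* Elementary polynomial inequalities for the pinned chain (`lam, β ≥ 0`): `H ≥ ∑(ω₂q_i²+p_i²)/2`,
  `|V'(r)| ≤ (3+β)(1+E)` if `V(r) ≤ E`, `(1+t)² ≤ 2e^s s⁻² e^{st}`.

## Design choices

* The semigroup statements are made for the interface `LangevinChainSemigroup` exactly as
  vendored (no new structure); finite invariant measures (the facts concern probability
  measures; the zero measure is trivially covered).
* Hypotheses are the weakest used: `C¹` potentials and `f ∈ C²_c` for continuity/compact support
  of `L f`; bounded measurable `L f` for the abstract vanishing lemma.
-/

noncomputable section

open MeasureTheory ProbabilityTheory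
open scoped ContDiff NNReal ENNReal

namespace Literature.MathematicalPhysics.KineticTheory.HeatConduction

variable {N : ℕ}

/-! ### Coordinate directions; `partialQ`/`partialP` as line derivatives -/

/- The coordinate directions of phase space are written as the literal vectors
`(Pi.single i 1, 0)` (position `q_i`; "unitQ" in the lemma names) and `(0, Pi.single i 1)`
(momentum `p_i`; "unitP"). -/

/-- Moving along `(e_i, 0)` shifts the position `q_i` only. [folklore] -/
@[simp] theorem add_smul_unitQ_fst (x : PhaseSpace N) (t : ℝ) (i : Fin N) :
    (x + t • ((Pi.single i 1, 0) : PhaseSpace N)).1 = x.1 + t • Pi.single i 1 := by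
  simp

/-- Moving along `(e_i, 0)` leaves the momenta fixed. [folklore] -/
@[simp] theorem add_smul_unitQ_snd (x : PhaseSpace N) (t : ℝ) (i : Fin N) :
    (x + t • ((Pi.single i 1, 0) : PhaseSpace N)).2 = x.2 := by
  simp

/-- Moving along `(0, e_i)` leaves the positions fixed. [folklore] -/
@[simp] theorem add_smul_unitP_fst (x : PhaseSpace N) (t : ℝ) (i : Fin N) :
    (x + t • ((0, Pi.single i 1) : PhaseSpace N)).1 = x.1 := by
  simp

/-- Moving along `(0, e_i)` shifts the momentum `p_i` only. [folklore] -/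
@[simp] theorem add_smul_unitP_snd (x : PhaseSpace N) (t : ℝ) (i : Fin N) :
    (x + t • ((0, Pi.single i 1) : PhaseSpace N)).2 = x.2 + t • Pi.single i 1 := by
  simp

/-- `q + t e_i = q[i ↦ q_i + t]`. [folklore] -/
theorem add_smul_single_eq_update (q : Fin N → ℝ) (t : ℝ) (i : Fin N) :
    q + t • Pi.single i 1 = Function.update q i (q i + t) := by
  ext j
  by_cases hj : j = i
  · subst hj; simp
  · simp [hj]

/-- The coordinate derivative `∂_{q_i}` of `FouriersLaw.lean` is Mathlib's line derivative along
`(e_i, 0)` (for every `f`, with the same junk value `0`). [folklore] -/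
theorem partialQ_eq_lineDeriv (i : Fin N) (f : PhaseSpace N → ℝ) (x : PhaseSpace N) :
    partialQ i f x = lineDeriv ℝ f x ((Pi.single i 1, 0) : PhaseSpace N) := by
  unfold partialQ lineDeriv
  have h : (fun t : ℝ => f (x + t • ((Pi.single i 1, 0) : PhaseSpace N))) =
      fun t => (fun s => f (Function.update x.1 i s, x.2)) (x.1 i + t) := by
    funext t
    rw [show x + t • ((Pi.single i 1, 0) : PhaseSpace N) =
        ((x + t • ((Pi.single i 1, 0) : PhaseSpace N)).1,
          (x + t • ((Pi.single i 1, 0) : PhaseSpace N)).2) from rfl,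
      add_smul_unitQ_fst, add_smul_unitQ_snd, add_smul_single_eq_update]
  rw [h, deriv_comp_const_add (fun s => f (Function.update x.1 i s, x.2)) (x.1 i) 0, add_zero]

/-- The coordinate derivative `∂_{p_i}` is the line derivative along `(0, e_i)`. [folklore] -/
theorem partialP_eq_lineDeriv (i : Fin N) (f : PhaseSpace N → ℝ) (x : PhaseSpace N) :
    partialP i f x = lineDeriv ℝ f x ((0, Pi.single i 1) : PhaseSpace N) := by
  unfold partialP lineDeriv
  have h : (fun t : ℝ => f (x + t • ((0, Pi.single i 1) : PhaseSpace N))) =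
      fun t => (fun s => f (x.1, Function.update x.2 i s)) (x.2 i + t) := by
    funext t
    rw [show x + t • ((0, Pi.single i 1) : PhaseSpace N) =
        ((x + t • ((0, Pi.single i 1) : PhaseSpace N)).1,
          (x + t • ((0, Pi.single i 1) : PhaseSpace N)).2) from rfl,
      add_smul_unitP_fst, add_smul_unitP_snd, add_smul_single_eq_update]
  rw [h, deriv_comp_const_add (fun s => f (x.1, Function.update x.2 i s)) (x.2 i) 0, add_zero]

/-- For differentiable `f`, `∂_{q_i} f = Df · (e_i, 0)`. [folklore] -/
theorem partialQ_eq_fderiv {f : PhaseSpace N → ℝ} (hf : Differentiable ℝ f) (i : Fin N) :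
    partialQ i f = fun x => fderiv ℝ f x ((Pi.single i 1, 0) : PhaseSpace N) := by
  funext x
  rw [partialQ_eq_lineDeriv, (hf x).lineDeriv_eq_fderiv]

/-- For differentiable `f`, `∂_{p_i} f = Df · (0, e_i)`. [folklore] -/
theorem partialP_eq_fderiv {f : PhaseSpace N → ℝ} (hf : Differentiable ℝ f) (i : Fin N) :
    partialP i f = fun x => fderiv ℝ f x ((0, Pi.single i 1) : PhaseSpace N) := by
  funext x
  rw [partialP_eq_lineDeriv, (hf x).lineDeriv_eq_fderiv]

/-- For differentiable `f`, `∂_{q_i} f` is the line derivative along `(e_i, 0)`. [folklore] -/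
theorem hasLineDerivAt_partialQ {f : PhaseSpace N → ℝ} (hf : Differentiable ℝ f) (i : Fin N)
    (x : PhaseSpace N) :
    HasLineDerivAt ℝ f (partialQ i f x) x ((Pi.single i 1, 0) : PhaseSpace N) := by
  rw [partialQ_eq_lineDeriv]
  exact (hf x).lineDifferentiableAt.hasLineDerivAt

/-- For differentiable `f`, `∂_{p_i} f` is the line derivative along `(0, e_i)`. [folklore] -/
theorem hasLineDerivAt_partialP {f : PhaseSpace N → ℝ} (hf : Differentiable ℝ f) (i : Fin N)
    (x : PhaseSpace N) :
    HasLineDerivAt ℝ f (partialP i f x) x ((0, Pi.single i 1) : PhaseSpace N) := by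
  rw [partialP_eq_lineDeriv]
  exact (hf x).lineDifferentiableAt.hasLineDerivAt

/-- For `f ∈ C¹`, the coordinate partial derivatives are continuous. [folklore] -/
theorem continuous_partialQ {f : PhaseSpace N → ℝ} {n : WithTop ℕ∞} (hf : ContDiff ℝ n f)
    (hn : n ≠ 0) (i : Fin N) : Continuous (partialQ i f) := by
  rw [partialQ_eq_fderiv (hf.differentiable hn)]
  exact (hf.continuous_fderiv hn).clm_apply continuous_const

/-- For `f ∈ C¹`, `∂_{p_i} f` is continuous. [folklore] -/
theorem continuous_partialP {f : PhaseSpace N → ℝ} {n : WithTop ℕ∞} (hf : ContDiff ℝ n f)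
    (hn : n ≠ 0) (i : Fin N) : Continuous (partialP i f) := by
  rw [partialP_eq_fderiv (hf.differentiable hn)]
  exact (hf.continuous_fderiv hn).clm_apply continuous_const

/-- For `f ∈ C^{m+1}`, `∂_{p_i} f ∈ C^m`. [folklore] -/
theorem contDiff_partialP {f : PhaseSpace N → ℝ} {m n : WithTop ℕ∞} (hf : ContDiff ℝ n f)
    (hmn : m + 1 ≤ n) (i : Fin N) : ContDiff ℝ m (partialP i f) := by
  have hn : n ≠ 0 := by
    rintro rfl
    exact absurd hmn (by simp)
  rw [partialP_eq_fderiv (hf.differentiable hn)]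
  exact (hf.fderiv_right hmn).clm_apply contDiff_const

/-- `∂_{p_i} f` has compact support if `f` has. [folklore] -/
theorem hasCompactSupport_partialP {f : PhaseSpace N → ℝ} (hf : Differentiable ℝ f)
    (hfc : HasCompactSupport f) (i : Fin N) : HasCompactSupport (partialP i f) := by
  rw [partialP_eq_fderiv hf]
  exact hfc.fderiv_apply ℝ ((0, Pi.single i 1) : PhaseSpace N)

/-- `∂_{q_i} f` has compact support if `f` has. [folklore] -/
theorem hasCompactSupport_partialQ {f : PhaseSpace N → ℝ} (hf : Differentiable ℝ f)
    (hfc : HasCompactSupport f) (i : Fin N) : HasCompactSupport (partialQ i f) := by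
  rw [partialQ_eq_fderiv hf]
  exact hfc.fderiv_apply ℝ ((Pi.single i 1, 0) : PhaseSpace N)

/-- Lebesgue measure on phase space is an additive Haar measure (product of two Haar measures);
recorded as a term, used to invoke Mathlib's integration by parts. [folklore] -/
theorem isAddHaarMeasure_volume_phaseSpace (N : ℕ) :
    (volume : Measure (PhaseSpace N)).IsAddHaarMeasure :=
  Measure.prod.instIsAddHaarMeasure _ _

namespace OscillatorChain

variable (P : OscillatorChain)

/-! ### Regularity of the Hamiltonian -/

/-- The Hamiltonian is as smooth as the potentials. [folklore] -/
theorem contDiff_hamiltonian {n : WithTop ℕ∞} (hU : ContDiff ℝ n P.U) (hV : ContDiff ℝ n P.V)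
    (N : ℕ) : ContDiff ℝ n (P.hamiltonian N) := by
  unfold hamiltonian
  have hq : ∀ i : Fin N, ContDiff ℝ n fun x : PhaseSpace N => x.1 i := fun i =>
    (contDiff_apply ℝ ℝ i).comp contDiff_fst
  have hp : ∀ i : Fin N, ContDiff ℝ n fun x : PhaseSpace N => x.2 i := fun i =>
    (contDiff_apply ℝ ℝ i).comp contDiff_snd
  apply ContDiff.add
  · exact ContDiff.sum fun i _ => (((hp i).pow 2).div_const 2).add (hU.comp (hq i))
  · refine ContDiff.sum fun i _ => ContDiff.sum fun j _ => ?_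
    by_cases h : j.val = i.val + 1
    · simp only [h, if_true]
      exact hV.comp ((hq j).sub (hq i))
    · simp only [h, if_false]
      exact contDiff_const

/-- The Hamiltonian is continuous if the potentials are. [folklore] -/
theorem continuous_hamiltonian (hU : Continuous P.U) (hV : Continuous P.V) (N : ℕ) :
    Continuous (P.hamiltonian N) :=
  (P.contDiff_hamiltonian (contDiff_zero.2 hU) (contDiff_zero.2 hV) N).continuous

/-- For a `C¹` Hamiltonian, `∂_{q_i} H` is continuous. [folklore] -/
theorem continuous_partialQ_hamiltonian {N : ℕ} (hH : ContDiff ℝ 1 (P.hamiltonian N)) (i : Fin N) :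
    Continuous (partialQ i (P.hamiltonian N)) := by
  have hd : Differentiable ℝ (P.hamiltonian N) := hH.differentiable one_ne_zero
  have : partialQ i (P.hamiltonian N) =
      fun x => fderiv ℝ (P.hamiltonian N) x ((Pi.single i 1, 0) : PhaseSpace N) := by
    funext x; rw [partialQ_eq_lineDeriv, (hd x).lineDeriv_eq_fderiv]
  rw [this]
  exact (hH.continuous_fderiv one_ne_zero).clm_apply continuous_const

/-! ### The generator on test functions: continuity, compact support, boundedness -/

/-- For `C¹` potentials and `f ∈ C²`, `L f` is continuous. [folklore] -/
theorem continuous_generator (hU : ContDiff ℝ 1 P.U) (hV : ContDiff ℝ 1 P.V) (N : ℕ)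
    (T_L T_R : ℝ) {f : PhaseSpace N → ℝ} (hf : ContDiff ℝ 2 f) :
    Continuous (P.generator N T_L T_R f) := by
  have hH : ContDiff ℝ 1 (P.hamiltonian N) := P.contDiff_hamiltonian hU hV N
  have h2 : (2 : WithTop ℕ∞) ≠ 0 := by norm_num
  have hq : ∀ i : Fin N, Continuous (partialQ i f) := fun i => continuous_partialQ hf h2 i
  have hp : ∀ i : Fin N, Continuous (partialP i f) := fun i => continuous_partialP hf h2 i
  have hpp : ∀ i : Fin N, Continuous (partialP i (partialP i f)) := fun i =>
    continuous_partialP (contDiff_partialP hf (m := 1) (by norm_num) i) one_ne_zero i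
  have hqH : ∀ i : Fin N, Continuous (partialQ i (P.hamiltonian N)) := fun i =>
    P.continuous_partialQ_hamiltonian hH i
  have hx2 : ∀ i : Fin N, Continuous fun x : PhaseSpace N => x.2 i := fun i =>
    (continuous_apply i).comp continuous_snd
  unfold generator
  refine Continuous.add (continuous_finsetSum _ fun i _ =>
    ((hx2 i).mul (hq i)).sub ((hqH i).mul (hp i))) (continuous_const.mul
      (continuous_finsetSum _ fun i _ => Continuous.add ?_ ?_))
  · by_cases h : i.val = 0
    · simp only [h, if_true]
      exact (continuous_const.mul (hpp i)).sub ((hx2 i).mul (hp i))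
    · simp only [h, if_false]
      exact continuous_const
  · by_cases h : i.val = N - 1
    · simp only [h, if_true]
      exact (continuous_const.mul (hpp i)).sub ((hx2 i).mul (hp i))
    · simp only [h, if_false]
      exact continuous_const

/-- For `f ∈ C²_c`, `L f` has compact support (every term carries a derivative of `f`).
[folklore] -/
theorem hasCompactSupport_generator (N : ℕ) (T_L T_R : ℝ) {f : PhaseSpace N → ℝ}
    (hf : ContDiff ℝ 2 f) (hfc : HasCompactSupport f) :
    HasCompactSupport (P.generator N T_L T_R f) := by
  have hd : Differentiable ℝ f := hf.differentiable (by norm_num)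
  have hd1 : ∀ i : Fin N, Differentiable ℝ (partialP i f) := fun i =>
    (contDiff_partialP hf (m := 1) (by norm_num) i).differentiable one_ne_zero
  have hq : ∀ i : Fin N, HasCompactSupport (partialQ i f) := fun i =>
    hasCompactSupport_partialQ hd hfc i
  have hp : ∀ i : Fin N, HasCompactSupport (partialP i f) := fun i =>
    hasCompactSupport_partialP hd hfc i
  have hpp : ∀ i : Fin N, HasCompactSupport (partialP i (partialP i f)) := fun i =>
    hasCompactSupport_partialP (hd1 i) (hp i) i
  simp only [hasCompactSupport_iff_eventuallyEq] at hq hp hpp ⊢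
  have hq' : ∀ᶠ x in Filter.coclosedCompact (PhaseSpace N), ∀ i, partialQ i f x = 0 :=
    Filter.eventually_all.mpr fun i => (hq i).mono fun x hx => hx
  have hp' : ∀ᶠ x in Filter.coclosedCompact (PhaseSpace N), ∀ i, partialP i f x = 0 :=
    Filter.eventually_all.mpr fun i => (hp i).mono fun x hx => hx
  have hpp' : ∀ᶠ x in Filter.coclosedCompact (PhaseSpace N),
      ∀ i, partialP i (partialP i f) x = 0 :=
    Filter.eventually_all.mpr fun i => (hpp i).mono fun x hx => hx
  filter_upwards [hq', hp', hpp'] with x hxq hxp hxpp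
  simp [generator, hxq, hxp, hxpp]

/-- For `C¹` potentials and `f ∈ C²_c`, `L f` is bounded. [folklore] -/
theorem exists_bound_generator (hU : ContDiff ℝ 1 P.U) (hV : ContDiff ℝ 1 P.V) (N : ℕ)
    (T_L T_R : ℝ) {f : PhaseSpace N → ℝ} (hf : ContDiff ℝ 2 f) (hfc : HasCompactSupport f) :
    ∃ C, ∀ x, ‖P.generator N T_L T_R f x‖ ≤ C :=
  (P.continuous_generator hU hV N T_L T_R hf).bounded_above_of_compact_support
    (P.hasCompactSupport_generator N T_L T_R hf hfc)

/-- For `C¹` potentials and `f ∈ C²_c`, `L f` is integrable for every finite measure. [folklore] -/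
theorem integrable_generator (hU : ContDiff ℝ 1 P.U) (hV : ContDiff ℝ 1 P.V) (N : ℕ)
    (T_L T_R : ℝ) {f : PhaseSpace N → ℝ} (hf : ContDiff ℝ 2 f) (hfc : HasCompactSupport f)
    (μ : Measure (PhaseSpace N)) [IsFiniteMeasure μ] :
    Integrable (P.generator N T_L T_R f) μ := by
  obtain ⟨C, hC⟩ := P.exists_bound_generator hU hV N T_L T_R hf hfc
  exact (integrable_const C).mono'
    (P.continuous_generator hU hV N T_L T_R hf).aestronglyMeasurable
    (Filter.Eventually.of_forall hC)

end OscillatorChain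

/-! ### Invariant measures of a Langevin-chain semigroup are weak steady states -/

namespace LangevinChainSemigroup

variable {P : OscillatorChain} {T_L T_R : ℝ} (S : LangevinChainSemigroup P N T_L T_R)

/-- `P_t g` is bounded by any bound of `g` (the kernels are probability measures). [folklore] -/
theorem norm_act_le (t : ℝ≥0) {g : PhaseSpace N → ℝ} {C : ℝ} (hC : ∀ x, ‖g x‖ ≤ C)
    (z : PhaseSpace N) : ‖S.act t g z‖ ≤ C := by
  rw [act_apply]
  calc ‖∫ y, g y ∂(S.kernel t z)‖ ≤ C * (S.kernel t z).real Set.univ :=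
        norm_integral_le_of_norm_le_const (Filter.Eventually.of_forall hC)
    _ = C := by simp

/-- `P_t g` is (strongly) measurable for measurable `g`. [folklore] -/
theorem stronglyMeasurable_act (t : ℝ≥0) {g : PhaseSpace N → ℝ} (hg : StronglyMeasurable g) :
    StronglyMeasurable (S.act t g) :=
  hg.integral_kernel (κ := S.kernel t)

/-- Joint measurability of `(z, s) ↦ P_s g (z)` (from the measurability field of the
interface). [folklore] -/
theorem stronglyMeasurable_uncurry_act {g : PhaseSpace N → ℝ} (hg : StronglyMeasurable g) :
    StronglyMeasurable fun p : PhaseSpace N × ℝ => S.act p.2.toNNReal g p.1 := by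
  let K : Kernel (ℝ≥0 × PhaseSpace N) (PhaseSpace N) :=
    ⟨fun p => S.kernel p.1 p.2, S.measurable_kernel⟩
  have h1 : StronglyMeasurable fun p : ℝ≥0 × PhaseSpace N => ∫ y, g y ∂(K p) :=
    hg.integral_kernel (κ := K)
  exact h1.comp_measurable ((measurable_snd.real_toNNReal).prodMk measurable_fst)

/-- **Invariance in integrated form**: `∫ P_t g dμ = ∫ g dμ` for an invariant measure `μ` and
`g ∈ L¹(μ)`. [folklore] -/
theorem IsInvariant.integral_act {μ : Measure (PhaseSpace N)} (hμ : S.IsInvariant μ) (t : ℝ≥0)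
    {g : PhaseSpace N → ℝ} (hg : Integrable g μ) :
    ∫ z, S.act t g z ∂μ = ∫ z, g z ∂μ := by
  have hint : Integrable g ((S.kernel t ∘ₖ Kernel.const Unit μ) ()) := by
    rw [← Measure.comp_eq_comp_const_apply, (hμ t).def]
    exact hg
  calc ∫ z, S.act t g z ∂μ
      = ∫ z, ∫ y, g y ∂(S.kernel t z) ∂(Kernel.const Unit μ ()) := by
        rw [Kernel.const_apply]; rfl
    _ = ∫ y, g y ∂((S.kernel t ∘ₖ Kernel.const Unit μ) ()) := (Kernel.integral_comp hint).symm
    _ = ∫ y, g y ∂μ := by rw [← Measure.comp_eq_comp_const_apply, (hμ t).def]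

/-- **Invariant measures are weakly stationary.** If `μ` is a finite invariant measure of a
Langevin-chain semigroup `S` and `f ∈ C_c^∞` has `L f` bounded and measurable, then
`∫ L f dμ = 0`: integrate Dynkin's identity `P_1 f - f = ∫₀¹ P_s(Lf) ds` against `μ` and use
invariance on both sides (Fubini on the right). [Cuneo–Eckmann–Hairer–Rey-Bellet 2018, §3
(p. 7, "a Markov process whose generator `L` is given by (3.2)")] [folklore] -/
theorem IsInvariant.integral_generator_eq_zero {μ : Measure (PhaseSpace N)} [IsFiniteMeasure μ]
    (hμ : S.IsInvariant μ) {f : PhaseSpace N → ℝ} (hf : ContDiff ℝ ∞ f)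
    (hfc : HasCompactSupport f) (hLm : StronglyMeasurable (P.generator N T_L T_R f))
    (hLb : ∃ C, ∀ x, ‖P.generator N T_L T_R f x‖ ≤ C) :
    ∫ x, P.generator N T_L T_R f x ∂μ = 0 := by
  set g := P.generator N T_L T_R f with hg_def
  obtain ⟨C, hC⟩ := hLb
  have hg_int : Integrable g μ :=
    (integrable_const C).mono' hLm.aestronglyMeasurable (Filter.Eventually.of_forall hC)
  -- `f` is bounded and integrable, and so is `P_1 f`
  obtain ⟨Cf, hCf⟩ := hf.continuous.bounded_above_of_compact_support hfc
  have hfsm : StronglyMeasurable f := hf.continuous.stronglyMeasurable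
  have hf_int : Integrable f μ :=
    (integrable_const Cf).mono' hfsm.aestronglyMeasurable (Filter.Eventually.of_forall hCf)
  have hPf_int : Integrable (S.act 1 f) μ :=
    (integrable_const Cf).mono' (S.stronglyMeasurable_act 1 hfsm).aestronglyMeasurable
      (Filter.Eventually.of_forall (S.norm_act_le 1 hCf))
  -- the right-hand side of Dynkin's identity, as a function on `PhaseSpace N × (0, 1]`
  set ν : Measure ℝ := volume.restrict (Set.Ioc 0 1) with hν
  have hGint : Integrable (Function.uncurry fun (z : PhaseSpace N) (s : ℝ) => S.act s.toNNReal g z)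
      (μ.prod ν) :=
    (integrable_const C).mono' (S.stronglyMeasurable_uncurry_act hLm).aestronglyMeasurable
      (Filter.Eventually.of_forall fun p => S.norm_act_le _ hC _)
  -- Dynkin at `t = 1`, integrated against `μ`
  have hD : ∀ z, S.act 1 f z - f z = ∫ s in (0:ℝ)..1, S.act s.toNNReal g z := by
    intro z
    have h := S.act_sub_self f hf hfc 1 z
    simpa using h
  have hlhs : ∫ z, (S.act 1 f z - f z) ∂μ = 0 := by
    rw [integral_sub hPf_int hf_int, hμ.integral_act S 1 hf_int, sub_self]
  have hrhs : ∫ z, (∫ s in (0:ℝ)..1, S.act s.toNNReal g z) ∂μ = ∫ z, g z ∂μ := by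
    simp_rw [intervalIntegral.integral_of_le zero_le_one]
    rw [← hν, integral_integral_swap hGint]
    have h : ∀ s : ℝ, ∫ z, S.act s.toNNReal g z ∂μ = ∫ z, g z ∂μ := fun s =>
      hμ.integral_act S _ hg_int
    simp_rw [h]
    rw [integral_const, measureReal_restrict_apply_univ, Real.volume_real_Ioc_of_le zero_le_one,
      sub_zero, one_smul]
  calc ∫ x, g x ∂μ = ∫ z, (∫ s in (0:ℝ)..1, S.act s.toNNReal g z) ∂μ := hrhs.symm
    _ = ∫ z, (S.act 1 f z - f z) ∂μ := integral_congr_ae (Filter.Eventually.of_forall fun z =>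
        (hD z).symm)
    _ = 0 := hlhs

/-- **Invariant probability measures are weak steady states** (`C¹` potentials): if `μ` is an
invariant probability measure of a Langevin-chain semigroup of `P` under which the bond currents
are integrable, then `μ` is an `OscillatorChain.IsSteadyState`. [Cuneo–Eckmann–Hairer–Rey-Bellet
2018, §3 (p. 7)] [folklore] -/
theorem IsInvariant.isSteadyState (hU : ContDiff ℝ 1 P.U) (hV : ContDiff ℝ 1 P.V)
    {μ : Measure (PhaseSpace N)} [IsProbabilityMeasure μ] (hμ : S.IsInvariant μ)
    (hj : ∀ i : Fin N, Integrable (P.bondCurrent N i) μ) : P.IsSteadyState N T_L T_R μ := by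
  refine ⟨inferInstance, fun f hf hfc => ?_, hj⟩
  have hf2 : ContDiff ℝ 2 f := hf.of_le (by norm_cast)
  exact hμ.integral_generator_eq_zero S hf hfc
    (P.continuous_generator hU hV N T_L T_R hf2).stronglyMeasurable
    (P.exists_bound_generator hU hV N T_L T_R hf2 hfc)

end LangevinChainSemigroup

/-! ### The pinned anharmonic chain: regularity and polynomial bounds -/

section Pinned

variable {ω₂ lam β : ℝ}

/-- The pinning potential `ω₂ q²/2 + lam q⁴/4` is smooth. [folklore] -/
theorem pinnedChain_contDiff_U (ω₂ lam β γ : ℝ) {n : WithTop ℕ∞} :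
    ContDiff ℝ n (pinnedChain ω₂ lam β γ).U := by
  show ContDiff ℝ n fun q : ℝ => ω₂ * q ^ 2 / 2 + lam * q ^ 4 / 4
  fun_prop

/-- The interaction potential `r²/2 + β r⁴/4` is smooth. [folklore] -/
theorem pinnedChain_contDiff_V (ω₂ lam β γ : ℝ) {n : WithTop ℕ∞} :
    ContDiff ℝ n (pinnedChain ω₂ lam β γ).V := by
  show ContDiff ℝ n fun r : ℝ => r ^ 2 / 2 + β * r ^ 4 / 4
  fun_prop

/-- `V'(r) = r + β r³`. [folklore] -/
theorem pinnedChain_deriv_V (ω₂ lam β γ r : ℝ) :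
    deriv (pinnedChain ω₂ lam β γ).V r = r + β * r ^ 3 := by
  have h : HasDerivAt (fun r : ℝ => r ^ 2 / 2 + β * r ^ 4 / 4)
      ((2 : ℕ) * r ^ (2 - 1) / 2 + β * ((4 : ℕ) * r ^ (4 - 1)) / 4) r :=
    ((hasDerivAt_pow 2 r).div_const 2).add (((hasDerivAt_pow 4 r).const_mul β).div_const 4)
  rw [show (pinnedChain ω₂ lam β γ).V = fun r : ℝ => r ^ 2 / 2 + β * r ^ 4 / 4 from rfl, h.deriv]
  norm_num
  ring

/-- `∑_i (ω₂ q_i²/2 + p_i²/2) ≤ H(q,p)` for the pinned chain with `lam, β ≥ 0`. [folklore] -/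
theorem pinnedChain_harmonic_le_hamiltonian (hl : 0 ≤ lam) (hβ : 0 ≤ β) (γ : ℝ) (N : ℕ)
    (x : PhaseSpace N) :
    (∑ i, ω₂ * x.1 i ^ 2 / 2) + ∑ i, x.2 i ^ 2 / 2 ≤ (pinnedChain ω₂ lam β γ).hamiltonian N x := by
  unfold OscillatorChain.hamiltonian
  have h1 : (∑ i, ω₂ * x.1 i ^ 2 / 2) + ∑ i, x.2 i ^ 2 / 2 ≤
      ∑ i, (x.2 i ^ 2 / 2 + (pinnedChain ω₂ lam β γ).U (x.1 i)) := by
    rw [← Finset.sum_add_distrib]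
    refine Finset.sum_le_sum fun i _ => ?_
    simp only [pinnedChain]
    nlinarith [mul_nonneg hl (by positivity : (0:ℝ) ≤ x.1 i ^ 4)]
  have h2 : 0 ≤ ∑ i : Fin N, ∑ j : Fin N,
      if j.val = i.val + 1 then (pinnedChain ω₂ lam β γ).V (x.1 j - x.1 i) else 0 := by
    refine Finset.sum_nonneg fun i _ => Finset.sum_nonneg fun j _ => ?_
    split_ifs
    · simp only [pinnedChain]; positivity
    · exact le_rfl
  linarith

/-- `|r| ≤ 1/2 + r²/2`. [folklore] -/
theorem abs_le_half_add_sq_half (r : ℝ) : |r| ≤ 1 / 2 + r ^ 2 / 2 := by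
  nlinarith [sq_nonneg (|r| - 1), sq_abs r, abs_nonneg r]

/-- `|r|³ ≤ (r² + r⁴)/2`. [folklore] -/
theorem abs_pow_three_le (r : ℝ) : |r| ^ 3 ≤ (r ^ 2 + r ^ 4) / 2 := by
  have h0 : 0 ≤ |r| := abs_nonneg r
  have h1 : |r| ^ 2 = r ^ 2 := sq_abs r
  nlinarith [sq_nonneg (|r| * (|r| - 1)), mul_nonneg h0 (sq_nonneg (|r| - 1))]

/-- `|V'(r)| = |r + β r³| ≤ (3 + β)(1 + E)` whenever `V(r) = r²/2 + β r⁴/4 ≤ E`, `β ≥ 0`.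
[folklore] -/
theorem abs_deriv_V_le (hβ : 0 ≤ β) {r E : ℝ} (hE : r ^ 2 / 2 + β * r ^ 4 / 4 ≤ E) :
    |r + β * r ^ 3| ≤ (3 + β) * (1 + E) := by
  have hE0 : 0 ≤ E := le_trans (by positivity) hE
  have h1 : |r + β * r ^ 3| ≤ |r| + β * |r| ^ 3 := by
    calc |r + β * r ^ 3| ≤ |r| + |β * r ^ 3| := abs_add_le _ _
      _ = |r| + β * |r| ^ 3 := by rw [abs_mul, abs_of_nonneg hβ, abs_pow]
  have h2 := abs_le_half_add_sq_half r
  have h3 := abs_pow_three_le r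
  have h4 : r ^ 2 / 2 ≤ E := by nlinarith [mul_nonneg hβ (by positivity : (0:ℝ) ≤ r ^ 4)]
  have h5 : β * r ^ 4 / 4 ≤ E := by nlinarith [sq_nonneg r]
  have h6 : β * |r| ^ 3 ≤ β * ((r ^ 2 + r ^ 4) / 2) := mul_le_mul_of_nonneg_left h3 hβ
  nlinarith [mul_le_mul_of_nonneg_left h4 hβ]

/-- `|p + p'| ≤ 1 + E` whenever `p²/2 + p'²/2 ≤ E`. [folklore] -/
theorem abs_add_le_one_add {p p' E : ℝ} (hE : p ^ 2 / 2 + p' ^ 2 / 2 ≤ E) : |p + p'| ≤ 1 + E := by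
  have := abs_add_le p p'
  have h1 := abs_le_half_add_sq_half p
  have h2 := abs_le_half_add_sq_half p'
  linarith

/-- `(1 + t)² ≤ (2 e^s / s²) e^{s t}` for `t ≥ 0`, `s > 0`. [folklore] -/
theorem one_add_sq_le_exp {t s : ℝ} (ht : 0 ≤ t) (hs : 0 < s) :
    (1 + t) ^ 2 ≤ 2 * Real.exp s / s ^ 2 * Real.exp (s * t) := by
  have h := Real.pow_div_factorial_le_exp (s * (1 + t)) (by positivity) 2
  simp only [Nat.factorial_two, Nat.cast_ofNat] at h
  rw [mul_add, mul_one, Real.exp_add] at h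
  have hs2 : 0 < s ^ 2 := by positivity
  rw [div_mul_eq_mul_div, le_div_iff₀ hs2]
  nlinarith [h]

/-- Two distinct kinetic terms are bounded by the energy. [folklore] -/
theorem pinnedChain_sq_add_sq_le_hamiltonian (hω : 0 ≤ ω₂) (hl : 0 ≤ lam) (hβ : 0 ≤ β) (γ : ℝ)
    (N : ℕ) (x : PhaseSpace N) {i j : Fin N} (hij : i ≠ j) :
    x.2 i ^ 2 / 2 + x.2 j ^ 2 / 2 ≤ (pinnedChain ω₂ lam β γ).hamiltonian N x := by
  have h := pinnedChain_harmonic_le_hamiltonian (ω₂ := ω₂) hl hβ γ N x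
  have h1 : x.2 i ^ 2 / 2 + x.2 j ^ 2 / 2 ≤ ∑ k, x.2 k ^ 2 / 2 := by
    rw [← Finset.sum_pair (f := fun k => x.2 k ^ 2 / 2) hij]
    exact Finset.sum_le_sum_of_subset_of_nonneg (Finset.subset_univ _)
      (fun k _ _ => by positivity)
  have h2 : 0 ≤ ∑ k, ω₂ * x.1 k ^ 2 / 2 := Finset.sum_nonneg fun k _ => by positivity
  linarith

/-- A single bond energy is bounded by the energy. [folklore] -/
theorem pinnedChain_bond_le_hamiltonian (hω : 0 ≤ ω₂) (hl : 0 ≤ lam) (hβ : 0 ≤ β) (γ : ℝ)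
    (N : ℕ) (x : PhaseSpace N) {i j : Fin N} (hj : j.val = i.val + 1) :
    (x.1 j - x.1 i) ^ 2 / 2 + β * (x.1 j - x.1 i) ^ 4 / 4 ≤
      (pinnedChain ω₂ lam β γ).hamiltonian N x := by
  unfold OscillatorChain.hamiltonian
  have h1 : 0 ≤ ∑ k, (x.2 k ^ 2 / 2 + (pinnedChain ω₂ lam β γ).U (x.1 k)) :=
    Finset.sum_nonneg fun k _ => by simp only [pinnedChain]; positivity
  have hnn : ∀ k l : Fin N,
      0 ≤ (if l.val = k.val + 1 then (pinnedChain ω₂ lam β γ).V (x.1 l - x.1 k) else 0) := by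
    intro k l
    split_ifs
    · simp only [pinnedChain]; positivity
    · exact le_rfl
  have h2 : (pinnedChain ω₂ lam β γ).V (x.1 j - x.1 i) ≤ ∑ k : Fin N, ∑ l : Fin N,
      (if l.val = k.val + 1 then (pinnedChain ω₂ lam β γ).V (x.1 l - x.1 k) else 0) := by
    calc (pinnedChain ω₂ lam β γ).V (x.1 j - x.1 i)
        = (if j.val = i.val + 1 then (pinnedChain ω₂ lam β γ).V (x.1 j - x.1 i) else 0) := by
          rw [if_pos hj]
      _ ≤ ∑ l : Fin N, (if l.val = i.val + 1 then (pinnedChain ω₂ lam β γ).V (x.1 l - x.1 i)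
          else 0) :=
          Finset.single_le_sum (f := fun l : Fin N => if l.val = i.val + 1 then
            (pinnedChain ω₂ lam β γ).V (x.1 l - x.1 i) else 0) (fun l _ => hnn i l)
            (Finset.mem_univ j)
      _ ≤ ∑ k : Fin N, ∑ l : Fin N,
          (if l.val = k.val + 1 then (pinnedChain ω₂ lam β γ).V (x.1 l - x.1 k) else 0) :=
          Finset.single_le_sum (f := fun k : Fin N => ∑ l : Fin N, if l.val = k.val + 1 then
            (pinnedChain ω₂ lam β γ).V (x.1 l - x.1 k) else 0)
            (fun k _ => Finset.sum_nonneg fun l _ => hnn k l) (Finset.mem_univ i)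
  have h3 : (pinnedChain ω₂ lam β γ).V (x.1 j - x.1 i) =
      (x.1 j - x.1 i) ^ 2 / 2 + β * (x.1 j - x.1 i) ^ 4 / 4 := rfl
  linarith

/-- **Polynomial bound on the currents**: `|j_i| ≤ N (3+β)/2 (1 + H)²`. [folklore] -/
theorem pinnedChain_abs_bondCurrent_le (hω : 0 ≤ ω₂) (hl : 0 ≤ lam) (hβ : 0 ≤ β) (γ : ℝ)
    (N : ℕ) (i : Fin N) (x : PhaseSpace N) :
    |(pinnedChain ω₂ lam β γ).bondCurrent N i x| ≤
      N * ((3 + β) / 2 * (1 + (pinnedChain ω₂ lam β γ).hamiltonian N x) ^ 2) := by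
  unfold OscillatorChain.bondCurrent
  have hH0 := pinnedChain_hamiltonian_nonneg hω hl hβ γ N x
  have hterm : ∀ j : Fin N, |(if j.val = i.val + 1 then
      -((x.2 i + x.2 j) / 2 * deriv (pinnedChain ω₂ lam β γ).V (x.1 j - x.1 i)) else 0)| ≤
      (3 + β) / 2 * (1 + (pinnedChain ω₂ lam β γ).hamiltonian N x) ^ 2 := by
    intro j
    split_ifs with hj
    · have hij : i ≠ j := by
        rintro rfl
        omega
      rw [pinnedChain_deriv_V, abs_neg, abs_mul, abs_div, abs_two]
      have hp := abs_add_le_one_add (pinnedChain_sq_add_sq_le_hamiltonian hω hl hβ γ N x hij)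
      have hv := abs_deriv_V_le hβ (pinnedChain_bond_le_hamiltonian hω hl hβ γ N x hj)
      calc |x.2 i + x.2 j| / 2 * |x.1 j - x.1 i + β * (x.1 j - x.1 i) ^ 3|
          ≤ (1 + (pinnedChain ω₂ lam β γ).hamiltonian N x) / 2 *
            ((3 + β) * (1 + (pinnedChain ω₂ lam β γ).hamiltonian N x)) :=
            mul_le_mul (by linarith) hv (abs_nonneg _) (by positivity)
        _ = (3 + β) / 2 * (1 + (pinnedChain ω₂ lam β γ).hamiltonian N x) ^ 2 := by ring
    · rw [abs_zero]; positivity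
  calc |∑ j : Fin N, (if j.val = i.val + 1 then
          -((x.2 i + x.2 j) / 2 * deriv (pinnedChain ω₂ lam β γ).V (x.1 j - x.1 i)) else 0)|
      ≤ ∑ j : Fin N, |(if j.val = i.val + 1 then
          -((x.2 i + x.2 j) / 2 * deriv (pinnedChain ω₂ lam β γ).V (x.1 j - x.1 i)) else 0)| :=
        Finset.abs_sum_le_sum_abs _ _
    _ ≤ ∑ _j : Fin N, (3 + β) / 2 * (1 + (pinnedChain ω₂ lam β γ).hamiltonian N x) ^ 2 :=
        Finset.sum_le_sum fun j _ => hterm j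
    _ = N * ((3 + β) / 2 * (1 + (pinnedChain ω₂ lam β γ).hamiltonian N x) ^ 2) := by
        simp [Finset.sum_const, Finset.card_univ, Fintype.card_fin]

/-- The bond currents of the pinned chain are continuous (polynomial). [folklore] -/
theorem pinnedChain_continuous_bondCurrent (ω₂ lam β γ : ℝ) (N : ℕ) (i : Fin N) :
    Continuous ((pinnedChain ω₂ lam β γ).bondCurrent N i) := by
  unfold OscillatorChain.bondCurrent
  simp only [pinnedChain_deriv_V]
  refine continuous_finsetSum _ fun j _ => ?_
  by_cases h : j.val = i.val + 1
  · simp only [h, if_true]; fun_prop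
  · simp only [h, if_false]; exact continuous_const

/-- The Hamiltonian of the pinned chain is continuous. [folklore] -/
theorem pinnedChain_continuous_hamiltonian (ω₂ lam β γ : ℝ) (N : ℕ) :
    Continuous ((pinnedChain ω₂ lam β γ).hamiltonian N) :=
  (pinnedChain ω₂ lam β γ).continuous_hamiltonian (pinnedChain_contDiff_U ω₂ lam β γ
    (n := 0)).continuous (pinnedChain_contDiff_V ω₂ lam β γ (n := 0)).continuous N

/-- **Exponential moments dominate the currents.** If `e^{ϑH} ∈ L¹(μ)` for some `ϑ > 0`
(`ω₂, lam, β ≥ 0`), the bond currents of the pinned chain are `μ`-integrable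
(`|j_i| ≤ N(3+β)/2 (1+H)² ≤ C_ϑ e^{ϑH}`). [folklore] -/
theorem pinnedChain_integrable_bondCurrent_of_integrable_exp (hω : 0 ≤ ω₂) (hl : 0 ≤ lam)
    (hβ : 0 ≤ β) (γ : ℝ) (N : ℕ) {μ : Measure (PhaseSpace N)} {ϑ : ℝ} (hϑ : 0 < ϑ)
    (hint : Integrable (fun x => Real.exp (ϑ * (pinnedChain ω₂ lam β γ).hamiltonian N x)) μ)
    (i : Fin N) : Integrable ((pinnedChain ω₂ lam β γ).bondCurrent N i) μ := by
  refine (hint.const_mul (N * ((3 + β) / 2) * (2 * Real.exp ϑ / ϑ ^ 2))).mono'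
    (pinnedChain_continuous_bondCurrent ω₂ lam β γ N i).aestronglyMeasurable
    (Filter.Eventually.of_forall fun x => ?_)
  have hH0 := pinnedChain_hamiltonian_nonneg hω hl hβ γ N x
  have hj := pinnedChain_abs_bondCurrent_le hω hl hβ γ N i x
  have hsq := one_add_sq_le_exp hH0 hϑ
  rw [Real.norm_eq_abs]
  calc |(pinnedChain ω₂ lam β γ).bondCurrent N i x|
      ≤ N * ((3 + β) / 2 * (1 + (pinnedChain ω₂ lam β γ).hamiltonian N x) ^ 2) := hj
    _ = N * ((3 + β) / 2) * (1 + (pinnedChain ω₂ lam β γ).hamiltonian N x) ^ 2 := by ring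
    _ ≤ N * ((3 + β) / 2) * (2 * Real.exp ϑ / ϑ ^ 2 *
          Real.exp (ϑ * (pinnedChain ω₂ lam β γ).hamiltonian N x)) :=
        mul_le_mul_of_nonneg_left hsq (by positivity)
    _ = N * ((3 + β) / 2) * (2 * Real.exp ϑ / ϑ ^ 2) *
          Real.exp (ϑ * (pinnedChain ω₂ lam β γ).hamiltonian N x) := by ring

/-- **Invariant measures of the pinned chain with an exponential moment are weak steady states.**
For `pinnedChain ω₂ lam β γ` (`ω₂, lam, β ≥ 0`, any `γ`), every invariant probability measure of
a Langevin-chain semigroup which integrates `e^{ϑH}` for some `ϑ > 0` is an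
`OscillatorChain.IsSteadyState`. [Cuneo–Eckmann–Hairer–Rey-Bellet 2018, §3 and Thm 2.13]
[folklore] -/
theorem pinnedChain_isSteadyState_of_isInvariant (hω : 0 ≤ ω₂) (hl : 0 ≤ lam) (hβ : 0 ≤ β)
    (γ : ℝ) (N : ℕ) {T_L T_R : ℝ} (S : LangevinChainSemigroup (pinnedChain ω₂ lam β γ) N T_L T_R)
    {μ : Measure (PhaseSpace N)} [IsProbabilityMeasure μ] (hμ : S.IsInvariant μ) {ϑ : ℝ}
    (hϑ : 0 < ϑ)
    (hint : Integrable (fun x => Real.exp (ϑ * (pinnedChain ω₂ lam β γ).hamiltonian N x)) μ) :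
    (pinnedChain ω₂ lam β γ).IsSteadyState N T_L T_R μ :=
  hμ.isSteadyState S (pinnedChain_contDiff_U ω₂ lam β γ) (pinnedChain_contDiff_V ω₂ lam β γ)
    (pinnedChain_integrable_bondCurrent_of_integrable_exp hω hl hβ γ N hϑ hint)

/-- **Theorem 2.13 implies the named fact.** The weak-stationarity corollary
`CuneoEckmannHairerReyBellet2018_pinnedChain` (`LangevinChainNESS.lean`) follows from Theorem 2.13
as vendored verbatim over the semigroup interface (`CuneoEckmannHairerReyBellet2018_thm213`,
`LangevinSemigroup.lean`): the invariant probability measure `μ⋆` of part (2) is a weak steady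
state by Dynkin's identity and invariance (`LangevinChainSemigroup.IsInvariant.isSteadyState`),
its bond currents being integrable because `e^{ϑH} ∈ L¹(μ⋆)` for `ϑ = 1/(2 max(T_L,T_R))`; it is
absolutely continuous by the smooth density of part (1); and part (2) is the exponential
integrability verbatim. [cite: CuneoEckmannHairerReyBellet2018, Thm 2.13] -/
theorem CuneoEckmannHairerReyBellet2018_pinnedChain_of_thm213
    (h : CuneoEckmannHairerReyBellet2018_thm213) : CuneoEckmannHairerReyBellet2018_pinnedChain := by
  intro ω₂ lam β γ hω hl hβ hγ N T_L T_R hN hL hR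
  obtain ⟨S, -, hsmooth, μ, hμ, hinv, hrest⟩ := h ω₂ lam β γ hω hl.le hβ hγ N T_L T_R hN hL hR
  have hmax : 0 < max T_L T_R := lt_max_of_lt_left hL
  have hϑ0 : 0 < 1 / max T_L T_R / 2 := by positivity
  have hϑ1 : 1 / max T_L T_R / 2 < 1 / max T_L T_R := half_lt_self (by positivity)
  exact ⟨μ, pinnedChain_isSteadyState_of_isInvariant hω.le hl.le hβ.le γ N S hinv hϑ0
      (hrest _ hϑ0 hϑ1).1,
    (hsmooth μ hμ hinv).absolutelyContinuous, fun ϑ h0 h1 => (hrest ϑ h0 h1).1⟩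

/-- Dot-notation alias: `h.pinnedChain_weak` for `h : CuneoEckmannHairerReyBellet2018_thm213`.
[cite: CuneoEckmannHairerReyBellet2018, Thm 2.13] -/
theorem CuneoEckmannHairerReyBellet2018_thm213.pinnedChain_weak
    (h : CuneoEckmannHairerReyBellet2018_thm213) : CuneoEckmannHairerReyBellet2018_pinnedChain :=
  CuneoEckmannHairerReyBellet2018_pinnedChain_of_thm213 h

end Pinned

end Literature.MathematicalPhysics.KineticTheory.HeatConduction

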